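import Literature.AlgebraicGeometry.Motives.JacobianStepOneOfLeaves
import Literature.AlgebraicGeometry.Motives.AbelianVarietyShearFibre
import Literature.AlgebraicGeometry.Motives.CartierDivisorIdealSheafPullback
import Literature.AlgebraicGeometry.Motives.CartierDivisorSubschemeReduced
import Literature.AlgebraicGeometry.Morphisms.EtaleLocusFibres
import Literature.AlgebraicGeometry.Resolution.AlterationsSeparableGenericallyEtale
import Literature.AlgebraicGeometry.Motives.GeometricallyIntegralAlgClosed
import HarnessLib

/-!
# Step I, road (E): the honest pull-backs `ι_a^* Θ₀` have all multiplicities `≤ 1` for `a` in a dense open set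
# (generic étaleness of the incidence `ψ : C × Z(Θ₀) → J`, characteristic `0`)

Layer `Literature/AlgebraicGeometry/Motives`, namespace `Literature.AlgebraicGeometry.Motives.Jacobian`.  THEOREMS ONLY; no definition, no named
fact, no instance.  Cell `hodgecm-mathlib` (D-0151), road G4 ∕ (3a) towards the interface row VI-8 (F-P2); architect ruling 08:19:17Z «ROAD (E)»;
this file PRODUCES the socket `hmult` of ★ `Jacobian.exists_open_ajSum_classPullback_shear_of_leaves` (`Motives/JacobianStepOneOfLeaves`).

## Statement

Let `C` be a smooth proper curve over an algebraically closed field `k` of characteristic `0`, `𝒥 : Jacobian C`, `P ∈ C(k)`, `α_P : C → J` the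
Abel–Jacobi map, and `Θ₀` an effective Cartier divisor on `J` with support EXACTLY `W̃_r(P)` whose closed subscheme `Z(Θ₀)` is INTEGRAL
(for the principal Riemann theta divisor this is «multiplicity `a = 1`», the (j) junction of the cell).  For `a ∈ J(k)` let `ι_a := α_P ≫ [−1] ≫ t_a`,
`Q ↦ a · α_P(Q)⁻¹`.  ASSUME (OPEN+TUPLE) `hopen`: for `a` in a non-empty open `U₁`, `a = ∏_j α_P(τ_j)` for an injective tuple
`τ : Fin (r+1) → C(k)`, unique up to permutation.  THEN there is a non-empty open `U₂ ⊆ J` such that for every `a ∈ U₂(k)`, whenever `Θ₀`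
avoids `ι_a(η_C)`, **every multiplicity of the honest pull-back `ι_a^* Θ₀` at a rational point is `≤ 1`**
(`exists_open_ordAt_pullbackAvoiding_shear_le_one`).

## Proof (Milne, *Jacobian Varieties*, proof of Lemma 6.7, in the generic-étaleness variant)

* the INCIDENCE `ψ : C × Z(Θ₀) → J`, `(Q, b) ↦ α_P(Q) · b`; its source is integral (`C` geometrically integral and smooth, `Z(Θ₀)` integral)
  and proper over `k`, so `ψ` is proper; `J` is irreducible and Jacobson;
* THE SHEAR ★ `AbelianVariety.isPullback_shear` (A-p08): the fibre of `ψ` over `a` is `C ×_{ι_a, J} Z(Θ₀)`, which is `Z(ι_a^*Θ₀)` by ★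
  `CartierDivisor.IsEffective.isPullback_subscheme_pullbackAvoiding` (A-p08); its points are the points `x ∈ C` with `ι_a(x) ∈ Supp Θ₀`,
  i.e. (★ (L-b) `pt_mul_inv_mem_compl_nonvanishing_iff_of_unique`, A-p03) the `r+1` points `τ_j` for `a ∈ U₁(k)` — FINITE AND NON-EMPTY;
* hence `ψ` is an alteration (★ `Morphisms.isAlteration_of_finite_nonempty_preimage_of_isClosed`, A-p07) and, in characteristic `0`,
  generically finite étale (★ `Resolution.IsAlteration.exists_isFinite_etale_morphismRestrict_of_charZero`, de Jong 2.20 ∕ EGA IV₄ 17.6.1),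
  so over a non-empty open `V` every field-valued fibre of `ψ` is REDUCED (★ `Morphisms.isReduced_of_isPullback_of_range_subset`, A-p07);
* for `a ∈ V(k)` the fibre is `Z(ι_a^*Θ₀)`, a reduced closed subscheme of the smooth curve `C`, so `ord_x(ι_a^*Θ₀) ≤ 1` at every closed point
  (★ `CurvePlaces.ordAt_le_one_of_isReduced_subscheme`, A-p08).

## References
* [Milne1986JacobianVarieties] J. S. Milne, *Jacobian Varieties*, in Cornell–Silverman (eds.), *Arithmetic Geometry* (1986), §6 Lemma 6.7 (p. 187),
  proof, and Remark 6.10 (a).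
* [Harris1992] J. Harris, *Algebraic Geometry: A First Course*, GTM 133 (1992), Prop. 7.16 (p. 80).
* [DeJong1996] A. J. de Jong, *Smoothness, semi-stability and alterations*, Publ. Math. IHÉS 83 (1996), 2.20 (p. 61).
-/

set_option autoImplicit false

noncomputable section

universe u

open CategoryTheory CategoryTheory.Limits AlgebraicGeometry MonoidalCategory CartesianMonoidalCategory MonObj
open Literature.AlgebraicGeometry.RelativeSpec Literature.AlgebraicGeometry.Morphisms

namespace Literature.AlgebraicGeometry.Motives

open CartierDivisor RatFn

namespace Jacobian

variable {k : Type u} [Field k] [IsAlgClosed k] [CharZero k] {C : SchemeOver k} [IsIntegral C.left]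
  [SmoothOfRelativeDimension 1 C.hom] [IsProper C.hom] (𝒥 : Jacobian C)

/-! ## §1 The incidence `ψ : C × Z(Θ₀) → J` and the shear square -/

section Incidence

variable (P : AlgPoints C k) {Θ₀ : CartierDivisor 𝒥.J.X.left} (h0 : Θ₀.IsEffective)

omit [IsAlgClosed k] [CharZero k] [SmoothOfRelativeDimension 1 C.hom] [IsProper C.hom] in
/-- **The fibre of the incidence `ψ = (fst ≫ α_P)·(snd ≫ ι_Z) : C × Z(Θ₀) → J` over `a` is the closed subscheme `Z(ι_a^*Θ₀)` of `C`**
(the shear ★ `AbelianVariety.isPullback_shear` composed with ★ `IsEffective.isPullback_subscheme_pullbackAvoiding`): a cartesian square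
`Z(ι_a^*Θ₀) → C × Z(Θ₀) —ψ→ J`, `Z(ι_a^*Θ₀) → Spec k —a→ J`. [cite: Milne1986JacobianVarieties, §6 Lemma 6.7 (p. 187), proof] -/
theorem isPullback_subscheme_shear_incidence (a : 𝒥.J.Points k)
    (hav : Θ₀.Avoids (((𝒥.abelJacobi P).left ≫ AbelianVariety.Hom.toSchemeHom ((-1 : ℤ) • 𝟙 𝒥.J) ≫
      (𝒥.J.translation a).left) (genericPoint C.left))) :
    let Zk : SchemeOver k := Over.mk (h0.idealSheaf.subschemeι ≫ 𝒥.J.X.hom)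
    let w : Zk ⟶ 𝒥.J.X := Over.homMk h0.idealSheaf.subschemeι rfl
    let ψ : C ⊗ Zk ⟶ 𝒥.J.X := (CartesianMonoidalCategory.fst C Zk ≫ 𝒥.abelJacobi P) * (CartesianMonoidalCategory.snd C Zk ≫ w)
    let ιa : C.left ⟶ 𝒥.J.X.left := (𝒥.abelJacobi P).left ≫ AbelianVariety.Hom.toSchemeHom ((-1 : ℤ) • 𝟙 𝒥.J) ≫
      (𝒥.J.translation a).left
    let E := Θ₀.pullbackAvoiding ιa hav
    let hE : E.IsEffective := h0.pullbackAvoiding ιa hav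
    ∃ t : (hE.idealSheaf.subscheme : Scheme.{u}) ⟶ (C ⊗ Zk).left,
      t ≫ (CartesianMonoidalCategory.fst C Zk).left = hE.idealSheaf.subschemeι ∧
      IsPullback t (hE.idealSheaf.subschemeι ≫ C.hom) ψ.left a.left := by
  intro Zk w ψ ιa E hE
  -- the shear as an `Over`-morphism and its normal form `a · α_P⁻¹`
  set sh : C ⟶ 𝒥.J.X := 𝒥.abelJacobi P ≫ ((-1 : ℤ) • 𝟙 𝒥.J :).hom.hom.hom ≫ 𝒥.J.translation a with hsh_def
  have hsh : sh = (toSpecOver C ≫ a) * (𝒥.abelJacobi P)⁻¹ := 𝒥.J.comp_neg_one_translation_eq (𝒥.abelJacobi P) a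
  have hshl : sh.left = ιa := rfl
  -- (P3-i): `Z(ι_a^*Θ₀) = C ×_J Z(Θ₀)`
  have hQ := h0.isPullback_subscheme_pullbackAvoiding ιa hav
  -- the second leg into `Z(Θ₀)` and the induced map into `C × Z(Θ₀) = C ×_k Z(Θ₀)`
  set q₂ := Scheme.IdealSheafData.subschemeMap _ h0.idealSheaf ιa
    ((h0.idealSheaf.le_map_comap ιa).trans_eq (congrArg (Scheme.IdealSheafData.map · ιa)
      (h0.idealSheaf_pullbackAvoiding ιa hav).symm)) with hq₂
  have hcompat : hE.idealSheaf.subschemeι ≫ C.hom = q₂ ≫ Zk.hom := by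
    change _ = q₂ ≫ h0.idealSheaf.subschemeι ≫ 𝒥.J.X.hom
    rw [← Category.assoc, ← hQ.w, Category.assoc]
    change hE.idealSheaf.subschemeι ≫ C.hom = hE.idealSheaf.subschemeι ≫ sh.left ≫ 𝒥.J.X.hom
    rw [Over.w sh]
  refine ⟨pullback.lift hE.idealSheaf.subschemeι q₂ hcompat, ?_, ?_⟩
  · change pullback.lift _ _ _ ≫ pullback.fst _ _ = _
    exact pullback.lift_fst _ _ _
  · exact AbelianVariety.isPullback_shear 𝒥.J (𝒥.abelJacobi P) w a ψ rfl sh hsh hQ _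
      (pullback.lift_fst _ _ _) (pullback.lift_snd _ _ _)

end Incidence

/-! ## §2 Points of the curve and of `Z(ι_a^*Θ₀)` -/

section Points

omit [CharZero k] [IsProper C.hom] in
/-- A rational point of the smooth curve `C` is not its generic point (`C(k)` is infinite, while a closed generic point would make `C`
a single point). [folklore] -/
private theorem pt_ne_genericPoint (Q : AlgPoints C k) : Q.pt ≠ genericPoint C.left := fun hgen => by
  have hcl : IsClosed ({Q.pt} : Set C.left) := Q.isClosed_singleton_pt
  have huniv : ({Q.pt} : Set C.left) = Set.univ := by
    rw [← hcl.closure_eq, hgen]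
    exact genericPoint_spec C.left
  have hsub : Function.Injective (fun R : AlgPoints C k => R.pt) := fun R R' h => AlgPoints.eq_of_pt_eq h
  haveI := infinite_algPoints C
  apply Set.infinite_univ (α := AlgPoints C k)
  refine Set.Finite.of_finite_image ?_ hsub.injOn
  exact (Set.finite_singleton Q.pt).subset (fun x _ => by rw [huniv]; trivial)

omit [IsAlgClosed k] [CharZero k] [IsProper C.hom] in
/-- Every non-generic point of the curve `C` is closed (dimension one). [folklore] -/
private theorem isClosed_singleton_of_ne_genericPoint {x : C.left} (hx : x ≠ genericPoint C.left) :
    IsClosed ({x} : Set C.left) :=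
  CurvePlaces.isClosed_singleton C hx

end Points

/-! ## §3 Multiplicity one on the étale locus of the incidence -/

section Multiplicity

variable (P : AlgPoints C k) (r : ℕ) {Θ₀ : CartierDivisor 𝒥.J.X.left} (h0 : Θ₀.IsEffective)

/-- **ROAD (E): THE HONEST PULL-BACKS `ι_a^* Θ₀` HAVE ALL MULTIPLICITIES `≤ 1` FOR `a` IN A DENSE OPEN SET** — the socket `hmult` of ★
`Jacobian.exists_open_ajSum_classPullback_shear_of_leaves`.  Hypotheses: `C` smooth proper over `k = k̄` of characteristic `0`, `𝒥` a
Jacobian, `Θ₀` effective with support exactly `W̃_r(P)` and INTEGRAL closed subscheme `Z(Θ₀)`, and (OPEN+TUPLE) `hopen` (module docstring).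
Proof: Milne's incidence `ψ : C × Z(Θ₀) → J` is an alteration whose fibre over `a` is `Z(ι_a^*Θ₀)` (§1); in characteristic `0` it is finite
étale over a dense open `V`, over which the fibres are reduced, and a reduced effective divisor on a smooth curve has multiplicities `≤ 1`.
[cite: Milne1986JacobianVarieties, §6 Lemma 6.7 (p. 187), proof, and Remark 6.10 (a)] [cite: Harris1992, Prop. 7.16 (p. 80)]
[cite: DeJong1996, 2.20, p. 61] -/
theorem exists_open_ordAt_pullbackAvoiding_shear_le_one [IsLocallyNoetherian C.left]
    (hsupp : (Θ₀.nonvanishing 1)ᶜ = 𝒥.brillNoetherLocus P r)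
    (hZ : IsIntegral (h0.idealSheaf.subscheme : Scheme.{u}))
    (hopen : ∃ U₁ : 𝒥.J.X.left.Opens, (U₁ : Set 𝒥.J.X.left).Nonempty ∧
      ∀ a : 𝒥.J.Points k, a.pt ∈ U₁ → ∃ τ : Fin (r + 1) → AlgPoints C k, Function.Injective τ ∧
        (∏ j : Fin (r + 1), τ j ≫ 𝒥.abelJacobi P) = a ∧
        ∀ τ' : Fin (r + 1) → AlgPoints C k, (∏ j : Fin (r + 1), τ' j ≫ 𝒥.abelJacobi P) = a →
          ∃ σ : Equiv.Perm (Fin (r + 1)), τ' = τ ∘ σ) :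
    ∃ U₂ : 𝒥.J.X.left.Opens, (U₂ : Set 𝒥.J.X.left).Nonempty ∧
      ∀ a : 𝒥.J.Points k, a.pt ∈ U₂ →
        ∀ hav : Θ₀.Avoids (((𝒥.abelJacobi P).left ≫ AbelianVariety.Hom.toSchemeHom ((-1 : ℤ) • 𝟙 𝒥.J) ≫
            (𝒥.J.translation a).left) (genericPoint C.left)),
        ∀ Q : AlgPoints C k,
          (Θ₀.pullbackAvoiding ((𝒥.abelJacobi P).left ≫ AbelianVariety.Hom.toSchemeHom ((-1 : ℤ) • 𝟙 𝒥.J) ≫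
            (𝒥.J.translation a).left) hav).ordAt Q.pt ≤ 1 := by
  classical
  obtain ⟨U₁, hU₁, h1⟩ := hopen
  -- the incidence `ψ : C × Z(Θ₀) → J`
  set Zk : SchemeOver k := Over.mk (h0.idealSheaf.subschemeι ≫ 𝒥.J.X.hom) with hZk
  set w : Zk ⟶ 𝒥.J.X := Over.homMk h0.idealSheaf.subschemeι rfl with hw
  set ψ : C ⊗ Zk ⟶ 𝒥.J.X := (CartesianMonoidalCategory.fst C Zk ≫ 𝒥.abelJacobi P) * (CartesianMonoidalCategory.snd C Zk ≫ w) with hψ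
  -- the shear `ι_a` as a function of `a`
  let ιa : 𝒥.J.Points k → (C.left ⟶ 𝒥.J.X.left) := fun a =>
    (𝒥.abelJacobi P).left ≫ AbelianVariety.Hom.toSchemeHom ((-1 : ℤ) • 𝟙 𝒥.J) ≫ (𝒥.J.translation a).left
  -- instances on the source `C ×_k Z(Θ₀)`, the target `J`, and `ψ`
  haveI : IsIntegral 𝒥.J.X.left := GeometricallyIntegral.isIntegral_of_subsingleton 𝒥.J.X.hom
  haveI : IsIntegral Zk.left := hZ
  haveI : LocallyOfFiniteType 𝒥.J.X.hom := inferInstance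
  haveI : IsLocallyNoetherian 𝒥.J.X.left := LocallyOfFiniteType.isLocallyNoetherian 𝒥.J.X.hom
  haveI : LocallyOfFiniteType Zk.hom := by
    change LocallyOfFiniteType (h0.idealSheaf.subschemeι ≫ 𝒥.J.X.hom); infer_instance
  haveI : IsLocallyNoetherian Zk.left := LocallyOfFiniteType.isLocallyNoetherian Zk.hom
  haveI : IsProper Zk.hom := by
    change IsProper (h0.idealSheaf.subschemeι ≫ 𝒥.J.X.hom); infer_instance
  haveI : GeometricallyIntegral C.hom := geometricallyIntegral_of_isAlgClosed C.hom
  haveI : Smooth C.hom := SmoothOfRelativeDimension.smooth 1 C.hom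
  haveI : IsIntegral (C ⊗ Zk).left := inferInstanceAs (IsIntegral (pullback C.hom Zk.hom))
  have hψw : ψ.left ≫ 𝒥.J.X.hom = (C ⊗ Zk).hom := Over.w ψ
  haveI : IsProper ((C ⊗ Zk).hom) := inferInstanceAs (IsProper (pullback.fst C.hom Zk.hom ≫ C.hom))
  haveI : IsProper ψ.left := by
    have : IsProper (ψ.left ≫ 𝒥.J.X.hom) := by rw [hψw]; infer_instance
    exact IsProper.of_comp ψ.left 𝒥.J.X.hom
  haveI : LocallyOfFiniteType ψ.left := by
    have : LocallyOfFiniteType (ψ.left ≫ 𝒥.J.X.hom) := by rw [hψw]; infer_instance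
    exact locallyOfFiniteType_of_comp ψ.left 𝒥.J.X.hom
  haveI : LocallyOfFinitePresentation ψ.left := inferInstance
  haveI : JacobsonSpace 𝒥.J.X.left := LocallyOfFiniteType.jacobsonSpace 𝒥.J.X.hom
  haveI : CharZero 𝒥.J.X.left.functionField :=
    charZero_of_injective_algebraMap (algebraMap k 𝒥.J.X.left.functionField).injective
  -- the FIBRE SET of `ψ` over a rational point `a ∈ U₁(k)` is finite and non-empty
  have hfibre : ∀ a : 𝒥.J.Points k, a.pt ∈ U₁ →
      (ψ.left.base ⁻¹' {a.pt}).Finite ∧ (ψ.left.base ⁻¹' {a.pt}).Nonempty := by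
    intro a ha
    obtain ⟨τ, hτinj, hτ, huniq⟩ := h1 a ha
    -- (L-b): rational points `Q` with `ι_a(Q) ∈ supp Θ₀` are the `τ_j`
    have hLb : ∀ Q : AlgPoints C k, (ιa a) Q.pt ∈ (Θ₀.nonvanishing 1)ᶜ ↔ Q ∈ Set.range τ := by
      intro Q
      rw [𝒥.shear_base_pt P a Q]
      exact 𝒥.pt_mul_inv_mem_compl_nonvanishing_iff_of_unique P τ a hτ huniq hsupp Q
    -- `Θ₀` avoids `ι_a(η_C)`: some rational point lies off the tuple
    haveI := infinite_algPoints C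
    obtain ⟨Q₀, hQ₀⟩ : ∃ Q₀ : AlgPoints C k, Q₀ ∉ Set.range τ := ((Set.finite_range τ).infinite_compl).nonempty
    have hav : Θ₀.Avoids ((ιa a) (genericPoint C.left)) := by
      have hQ₀'' : (ιa a) Q₀.pt ∈ Θ₀.nonvanishing 1 := by
        by_contra hn
        exact hQ₀ ((hLb Q₀).mp hn)
      exact Avoids.of_specializes (((genericPoint_spec C.left).specializes (Set.mem_univ Q₀.pt)).map (ιa a).continuous)
        ((avoids_iff_mem_nonvanishing_one).mpr hQ₀'')
    -- the shear square for `Q = Z(ι_a^*Θ₀)`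
    obtain ⟨t, ht₁, sq⟩ := 𝒥.isPullback_subscheme_shear_incidence P h0 a hav
    set E := Θ₀.pullbackAvoiding (ιa a) hav with hE
    have hEeff : E.IsEffective := h0.pullbackAvoiding (ιa a) hav
    -- points of `Z(E)` ↪ points of `C` where `E` does not avoid, which lie among the `τ_j`
    have hEav : ∀ x : C.left, ¬ E.Avoids x → ∃ j, (τ j).pt = x := by
      intro x hx
      have hxgen : x ≠ genericPoint C.left := by
        rintro rfl
        exact hx (fun i hi => (hav i.1 hi).pullbackFn)
      obtain ⟨Q, hQ⟩ := AlgPoints.exists_pt_eq_of_isClosed_singleton (X := C) (isClosed_singleton_of_ne_genericPoint hxgen)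
      subst hQ
      have hmem : (ιa a) Q.pt ∈ (Θ₀.nonvanishing 1)ᶜ := by
        intro hn
        apply hx
        have hΘ : Θ₀.Avoids ((ιa a) Q.pt) := (avoids_iff_mem_nonvanishing_one).mpr hn
        exact fun i hi => (hΘ i.1 hi).pullbackFn
      obtain ⟨j, hj⟩ := (hLb Q).mp hmem
      exact ⟨j, by rw [hj]⟩
    have hrange : Set.range hEeff.idealSheaf.subschemeι.base ⊆ (fun j => (τ j).pt) '' Set.univ := by
      rintro x hx
      rw [hEeff.mem_range_subschemeι_iff] at hx
      obtain ⟨j, hj⟩ := hEav x hx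
      exact ⟨j, Set.mem_univ _, hj⟩
    have hZfin : (Set.univ : Set ↥(hEeff.idealSheaf.subscheme)).Finite := by
      have hinj : Function.Injective hEeff.idealSheaf.subschemeι.base :=
        hEeff.idealSheaf.subschemeι.isClosedEmbedding.injective
      refine Set.Finite.of_finite_image ?_ hinj.injOn
      rw [Set.image_univ]
      exact ((Set.finite_univ.image _).subset hrange)
    -- `range t = ψ⁻¹ {a.pt}` from the cartesian square
    have hrt : Set.range t.base = ψ.left.base ⁻¹' {a.pt} := by
      have h1' : Set.range t.base = Set.range (pullback.fst ψ.left a.left).base := by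
        apply le_antisymm
        · rintro _ ⟨z, rfl⟩
          exact ⟨sq.isoPullback.hom.base z, congrArg (fun f => f.base z) sq.isoPullback_hom_fst⟩
        · rintro _ ⟨y, rfl⟩
          exact ⟨sq.isoPullback.inv.base y, congrArg (fun f => f.base y) sq.isoPullback_inv_fst⟩
      rw [h1', Scheme.Pullback.range_fst]
      congr 1
      haveI : Unique ↥(specOver k k).left := inferInstanceAs (Unique (PrimeSpectrum k))
      ext y
      constructor
      · rintro ⟨z, rfl⟩
        rw [Subsingleton.elim z (IsLocalRing.closedPoint k)]
        rfl
      · rintro rfl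
        exact ⟨IsLocalRing.closedPoint k, rfl⟩
    refine ⟨?_, ?_⟩
    · rw [← hrt, ← Set.image_univ]
      exact hZfin.image _
    · -- `τ 0` gives a point of `Z(E)`, hence of the fibre
      have h0pt : ¬ E.Avoids (τ 0).pt := by
        intro hav0
        have hpos := (ordAt_pullbackAvoiding_pos_iff (ιa a) h0 hav (pt_ne_genericPoint (τ 0))).mpr
          ((hLb (τ 0)).mpr ⟨0, rfl⟩)
        have := hav0.ordAt_eq_zero
        rw [← hE] at hpos
        omega
      obtain ⟨z, hz⟩ := (hEeff.mem_range_subschemeι_iff).mpr h0pt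
      exact ⟨t.base z, by rw [← hrt]; exact ⟨z, rfl⟩⟩
  -- (P2): generic étaleness in characteristic `0` ⇒ reduced fibres over a dense open `V`
  have hfin : ∀ s : 𝒥.J.X.left, s ∈ U₁ → IsClosed ({s} : Set 𝒥.J.X.left) → (ψ.left.base ⁻¹' {s}).Finite := by
    intro s hs hscl
    obtain ⟨a, rfl⟩ := AlgPoints.exists_pt_eq_of_isClosed_singleton (X := 𝒥.J.X) hscl
    exact (hfibre a hs).1
  have hne : ∀ s : 𝒥.J.X.left, s ∈ U₁ → IsClosed ({s} : Set 𝒥.J.X.left) → (ψ.left.base ⁻¹' {s}).Nonempty := by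
    intro s hs hscl
    obtain ⟨a, rfl⟩ := AlgPoints.exists_pt_eq_of_isClosed_singleton (X := 𝒥.J.X) hscl
    exact (hfibre a hs).2
  obtain ⟨V, hV, _hfinV, hetV, _hred, hredΩ⟩ := exists_opens_finite_etale_isReduced_of_core ψ.left
    (fun halt => halt.exists_isFinite_etale_morphismRestrict_of_charZero) U₁ hU₁ hfin hne
  refine ⟨V, hV, fun a ha hav Q => ?_⟩
  -- the fibre `Z(ι_a^*Θ₀)` over `a ∈ V(k)` is reduced
  obtain ⟨t, _ht₁, sq⟩ := 𝒥.isPullback_subscheme_shear_incidence P h0 a hav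
  have hs : Set.range a.left.base ⊆ (V : Set 𝒥.J.X.left) :=
    range_subset_of_apply_closedPoint_mem V a.left ha
  haveI : IsReduced ((h0.pullbackAvoiding _ hav).idealSheaf.subscheme : Scheme.{u}) :=
    isReduced_of_isPullback_of_range_subset ψ.left V hs sq
  exact CurvePlaces.ordAt_le_one_of_isReduced_subscheme (h0.pullbackAvoiding _ hav) (pt_ne_genericPoint Q)

end Multiplicity

end Jacobian

end Literature.AlgebraicGeometry.Motives

end
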